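import Mathlib
import HarnessLib
import Summits.AtomisticToContinuum.FouriersLaw.Theses.JunctionLocality
import Summits.AtomisticToContinuum.FouriersLaw.Theorems.JunctionLocalitySuperadditiveResistanceDeviceLiouville
import Summits.AtomisticToContinuum.FouriersLaw.Theorems.JunctionLocalitySuperadditiveResistancePlainAdjoint
import Summits.AtomisticToContinuum.FouriersLaw.Theorems.JunctionLocalitySuperadditiveResistanceStubDeviceForwardFieldsAux2
import Summits.AtomisticToContinuum.FouriersLaw.Theorems.JunctionLocalitySuperadditiveResistanceStubDeviceForwardFieldsAux3
import Summits.AtomisticToContinuum.FouriersLaw.Theorems.JunctionLocalitySuperadditiveResistanceStubDeviceForwardFieldsAux4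
import Summits.AtomisticToContinuum.FouriersLaw.Theorems.JunctionLocalitySuperadditiveResistanceStubDeviceForwardFieldsAux5
import Literature.MathematicalPhysics.KineticTheory.PhaseSpacePoisson

/-!
# Forward fields of the γ-probed device, VI: resolvent fields `(λ − L)⁻¹ k` exist in `L²(μ_T)`
(helper toward stub `stub_deviceForwardFields` of line `floating-probe-bypass-laplacian`,
crux stmt-AtomisticToContinuum-11748; Part VI, see Part I `…StubDeviceForwardFieldsAux1` for the
overview)

**Essential m-dissipativity of `L = σ X_H + c S_B` on `C_c^∞ ⊂ L²(μ_T)` and the resolvent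
fields.** For `pinnedChain ω₂ lam β γ` (`ω₂ > 0`, `lam, β ≥ 0`), `L ≥ 1` sites, `T > 0`, `σ ≠ 0`,
`c > 0`, site weights `B ≥ 0` with `B_0 > 0`, and every `λ > 0`:
* `exists_resolvent_weak` — for every `k ∈ L²(μ_T)` there is `g ∈ L²(μ_T)` solving
  `(λ − L) g = k` weakly (`∫ (−σ X_H φ + c S_B φ − λφ) g dμ_T = −∫ k φ dμ_T`, `φ ∈ C_c^∞`).
  Proof (Hilbert space only): the range of `λ − L` on `C_c^∞` is dense in `L²(μ_T)` — a vector
  orthogonal to it is a weak solution of `(λ − L^†) v = 0`, smooth by Part III and zero by the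
  dissipativity of Part IV — and `λ‖ψ‖ ≤ ‖(λ − L)ψ‖` (Part V), so approximating `k` by
  `(λ − L)ψ_n` makes `ψ_n` Cauchy; its limit is the weak solution (adjointness, Part II).
* `exists_resolventField` — for smooth `k ∈ L²(μ_T)` the weak solution is a.e. a smooth
  `g_λ ∈ L²(μ_T)` with `λ g_λ − (σ X_H g_λ + c S_B g_λ) = k` POINTWISE (Part III);
* `exists_deviceResolventField` — the device (`σ = 1`, `c = γ`, `B = deviceWeight`,
  `k = p_s² − T ∈ L²(μ_T)` by `pinnedChain_memLp_two_kin`): for every `λ > 0` a smooth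
  `g_λ ∈ L²(μ_T)` with `λ g_λ − L_dev g_λ = p_s² − T` pointwise.
So the only missing input for the forward fields `g = lim_{λ→0} g_λ` of the stub is a bound on
`‖g_λ‖_{L²(μ_T)}` uniform in `λ` (finite Green–Kubo integral / quantitative ergodicity of the
device). Mechanism: Helffer–Nier, *Hypoelliptic Estimates and Spectral Theory for Fokker–Planck
Operators* (LNM 1862, 2005) §5.2; Eckmann–Pillet–Rey-Bellet CMP 201 (1999) §3. No definitions.
Axioms: `propext`, `Classical.choice`, `Quot.sound`.
-/

noncomputable section

open MeasureTheory Filter Topology ProbabilityTheory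
open scoped ContDiff NNReal InnerProductSpace
open Literature.MathematicalPhysics.KineticTheory.HeatConduction
open Summit.AtomisticToContinuum.FouriersLaw.Theorems.SuperadditiveResistance.DeviceLiouville

namespace Summit.AtomisticToContinuum.FouriersLaw.Cruxes.SuperadditiveResistance.FloatingProbeBypassLaplacian

section ResolventExistence

open Distributions

variable {ω₂ lam β : ℝ} {L : ℕ}

/-- Linearity of `σ X_H + c S_B + κ` on `C²`: additivity. [folklore] -/
theorem genOp_add (P : OscillatorChain) (σ c κ : ℝ) (B : Fin L → ℝ) (T : ℝ)
    {f g : PhaseSpace L → ℝ} (hf : ContDiff ℝ 2 f) (hg : ContDiff ℝ 2 g) (x : PhaseSpace L) :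
    σ * liouvilleOp P L (f + g) x + c * bathOp L B T (f + g) x + κ * (f + g) x =
      (σ * liouvilleOp P L f x + c * bathOp L B T f x + κ * f x) +
        (σ * liouvilleOp P L g x + c * bathOp L B T g x + κ * g x) := by
  rw [liouvilleOp_add' P (hf.differentiable two_ne_zero) (hg.differentiable two_ne_zero),
    bathOp_add' hf hg, Pi.add_apply]
  ring

/-- Linearity of `σ X_H + c S_B + κ` on `C²`: homogeneity. [folklore] -/
theorem genOp_smul (P : OscillatorChain) (σ c κ : ℝ) (B : Fin L → ℝ) (T : ℝ) (a : ℝ)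
    (f : PhaseSpace L → ℝ) (x : PhaseSpace L) :
    σ * liouvilleOp P L (a • f) x + c * bathOp L B T (a • f) x + κ * (a • f) x =
      a * (σ * liouvilleOp P L f x + c * bathOp L B T f x + κ * f x) := by
  have h : (a • f) = fun y => a * f y := rfl
  rw [h, liouvilleOp_const_mul, bathOp_const_mul]
  simp only
  ring

/-- **Resolvent fields exist, weak form: the range of `λ − (σ X_H + c S_B)` on `C_c^∞` is dense in
`L²(μ_T)` and `λ‖ψ‖ ≤ ‖(λ − L)ψ‖`.** For the pinned chain (`ω₂ > 0`, `lam, β ≥ 0`), `L ≥ 1`,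
`T > 0`, `σ ≠ 0`, `c > 0`, `B ≥ 0` with `B_0 > 0`, `λ > 0` and `k ∈ L²(μ_T)`: there is
`g ∈ L²(μ_T)` with `∫ (−σ X_H φ + c S_B φ − λ φ) g dμ_T = −∫ k φ dμ_T` for all `φ ∈ C_c^∞`
(i.e. `(λ − σ X_H − c S_B) g = k` weakly). [folklore] -/
theorem exists_resolvent_weak (hω : 0 < ω₂) (hl : 0 ≤ lam) (hβ : 0 ≤ β) (γ : ℝ) (hL : 0 < L)
    {T : ℝ} (hT : 0 < T) {σ c : ℝ} (hσ : σ ≠ 0) (hc : 0 < c) {B : Fin L → ℝ} (hB : ∀ i, 0 ≤ B i)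
    (hB0 : 0 < B ⟨0, hL⟩) {lam0 : ℝ} (hlam : 0 < lam0) {k : PhaseSpace L → ℝ}
    (hk : MemLp k 2 ((pinnedChain ω₂ lam β γ).gibbsMeasure L T)) :
    ∃ g : PhaseSpace L → ℝ, MemLp g 2 ((pinnedChain ω₂ lam β γ).gibbsMeasure L T) ∧
      ∀ φ : PhaseSpace L → ℝ, ContDiff ℝ ∞ φ → HasCompactSupport φ →
        ∫ x, (-σ * liouvilleOp (pinnedChain ω₂ lam β γ) L φ x + c * bathOp L B T φ x +
            (-lam0) * φ x) * g x ∂((pinnedChain ω₂ lam β γ).gibbsMeasure L T) =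
          ∫ x, (-k x) * φ x ∂((pinnedChain ω₂ lam β γ).gibbsMeasure L T) := by
  set P := pinnedChain ω₂ lam β γ with hP
  haveI : IsProbabilityMeasure (P.gibbsMeasure L T) :=
    pinnedChain_isProbabilityMeasure_gibbsMeasure hω hl hβ γ L hT
  have hU1 : ContDiff ℝ 1 P.U := pinnedChain_contDiff_U ω₂ lam β γ
  have hV1 : ContDiff ℝ 1 P.V := pinnedChain_contDiff_V ω₂ lam β γ
  have hρint : Integrable (P.gibbsDensity L T) := pinnedChain_integrable_gibbsDensity hω hl hβ γ L hT
  have hZpos : 0 < (∫ x, P.gibbsDensity L T x)⁻¹ := inv_pos.2 (integral_exp_pos hρint)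
  -- test functions: regularity and `L²` membership of `ψ` and of `N ψ = λψ − σX_Hψ − cS_Bψ`
  have hD2 : ∀ ψ : 𝓓((⊤ : TopologicalSpace.Opens (PhaseSpace L)), ℝ), ContDiff ℝ 2 ψ :=
    fun ψ => ψ.contDiff.of_le (by norm_cast)
  have hψmem : ∀ ψ : 𝓓((⊤ : TopologicalSpace.Opens (PhaseSpace L)), ℝ),
      MemLp (ψ : PhaseSpace L → ℝ) 2 (P.gibbsMeasure L T) := fun ψ =>
    memLp_two_of_hasCompactSupport _ ψ.continuous ψ.hasCompactSupport
  have hNmem : ∀ ψ : 𝓓((⊤ : TopologicalSpace.Opens (PhaseSpace L)), ℝ),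
      MemLp (fun x => (-σ) * liouvilleOp P L ψ x + (-c) * bathOp L B T ψ x + lam0 * ψ x) 2
        (P.gibbsMeasure L T) := fun ψ =>
    memLp_two_of_hasCompactSupport _ (continuous_genOp hU1 hV1 L (-σ) (-c) lam0 B T (hD2 ψ))
      (hasCompactSupport_genOp L (-σ) (-c) lam0 B T (hD2 ψ) ψ.hasCompactSupport)
  -- the two linear maps `Ψ : ψ ↦ [ψ]` and `Φ : ψ ↦ [N ψ]` into `L²(μ_T)`
  let Ψ : 𝓓((⊤ : TopologicalSpace.Opens (PhaseSpace L)), ℝ) →ₗ[ℝ] Lp ℝ 2 (P.gibbsMeasure L T) :=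
    { toFun := fun ψ => (hψmem ψ).toLp (ψ : PhaseSpace L → ℝ)
      map_add' := fun ψ φ => by
        rw [← MemLp.toLp_add (hψmem ψ) (hψmem φ)]
        exact (MemLp.toLp_eq_toLp_iff _ _).2 (ae_of_all _ fun x => by simp)
      map_smul' := fun a ψ => by
        rw [RingHom.id_apply, ← MemLp.toLp_const_smul a (hψmem ψ)]
        exact (MemLp.toLp_eq_toLp_iff _ _).2 (ae_of_all _ fun x => by simp) }
  let Φ : 𝓓((⊤ : TopologicalSpace.Opens (PhaseSpace L)), ℝ) →ₗ[ℝ] Lp ℝ 2 (P.gibbsMeasure L T) :=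
    { toFun := fun ψ => (hNmem ψ).toLp _
      map_add' := fun ψ φ => by
        rw [← MemLp.toLp_add (hNmem ψ) (hNmem φ)]
        refine (MemLp.toLp_eq_toLp_iff _ _).2 (ae_of_all _ fun x => ?_)
        simp only [Pi.add_apply]
        rw [FunLike.coe_add]
        exact genOp_add P (-σ) (-c) lam0 B T (hD2 ψ) (hD2 φ) x
      map_smul' := fun a ψ => by
        rw [RingHom.id_apply, ← MemLp.toLp_const_smul a (hNmem ψ)]
        refine (MemLp.toLp_eq_toLp_iff _ _).2 (ae_of_all _ fun x => ?_)
        simp only [Pi.smul_apply, smul_eq_mul]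
        rw [FunLike.coe_smul]
        exact genOp_smul P (-σ) (-c) lam0 B T a ψ x }
  have hΨ : ∀ ψ, Ψ ψ = (hψmem ψ).toLp (ψ : PhaseSpace L → ℝ) := fun ψ => rfl
  have hΦ : ∀ ψ, Φ ψ = (hNmem ψ).toLp _ := fun ψ => rfl
  -- (E) coercivity: λ‖Ψ ψ‖ ≤ ‖Φ ψ‖
  have hE : ∀ ψ, lam0 * ‖Ψ ψ‖ ≤ ‖Φ ψ‖ := by
    intro ψ
    have h1 : lam0 * ‖Ψ ψ‖ ^ 2 ≤ ⟪Φ ψ, Ψ ψ⟫_ℝ := by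
      rw [hΨ, hΦ, norm_toLp_sq, inner_toLp_toLp]
      have := integral_resolventOp_mul_self_ge P hU1 hV1 L hT σ hc.le hB lam0 (hD2 ψ)
        ψ.hasCompactSupport
      refine this.trans (le_of_eq (integral_congr_ae (ae_of_all _ fun x => ?_)))
      simp only
      ring
    have h2 : ⟪Φ ψ, Ψ ψ⟫_ℝ ≤ ‖Φ ψ‖ * ‖Ψ ψ‖ := real_inner_le_norm _ _
    have h3 : lam0 * ‖Ψ ψ‖ * ‖Ψ ψ‖ ≤ ‖Φ ψ‖ * ‖Ψ ψ‖ := by nlinarith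
    rcases (norm_nonneg (Ψ ψ)).eq_or_lt with h0 | hpos
    · rw [← h0, mul_zero]
      exact norm_nonneg _
    · exact le_of_mul_le_mul_right h3 hpos
  -- (D) density of the range of `Φ`
  have hD : (LinearMap.range Φ)ᗮ = ⊥ := by
    rw [Submodule.eq_bot_iff]
    intro v hv
    have hv' : ∀ ψ, ⟪Φ ψ, v⟫_ℝ = 0 := fun ψ =>
      Submodule.inner_right_of_mem_orthogonal (LinearMap.mem_range_self Φ ψ) hv
    have hvw : ∀ φ : PhaseSpace L → ℝ, ContDiff ℝ ∞ φ → HasCompactSupport φ →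
        ∫ x, (-(-σ) * liouvilleOp P L φ x + c * bathOp L B T φ x + (-lam0) * φ x) * v x
            ∂(P.gibbsMeasure L T) =
          ∫ x, (fun _ => (0 : ℝ)) x * φ x ∂(P.gibbsMeasure L T) := by
      intro φ hφ hφc
      let Φ0 : 𝓓((⊤ : TopologicalSpace.Opens (PhaseSpace L)), ℝ) := ⟨φ, hφ, hφc, by simp⟩
      have e := hv' Φ0
      rw [hΦ, inner_toLp_left] at e
      simp only [zero_mul, integral_zero]
      have e2 : ∫ x, (-(-σ) * liouvilleOp P L φ x + c * bathOp L B T φ x + (-lam0) * φ x) * v x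
          ∂(P.gibbsMeasure L T) =
          -∫ x, ((-σ) * liouvilleOp P L Φ0 x + (-c) * bathOp L B T Φ0 x + lam0 * Φ0 x) * v x
            ∂(P.gibbsMeasure L T) := by
        rw [← integral_neg]
        exact integral_congr_ae (ae_of_all _ fun x => by
          show _ = -(((-σ) * liouvilleOp P L φ x + (-c) * bathOp L B T φ x + lam0 * φ x) * v x)
          ring)
      rw [e2, e, neg_zero]
    obtain ⟨v', hv'C, hae, hpde⟩ := exists_classical_of_weak_gibbs hω hl hβ γ hL hT
      (neg_ne_zero.2 hσ) hc hB hB0 (-lam0) ((Lp.memLp v).integrable one_le_two) contDiff_const hvw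
    have hv'2 : MemLp v' 2 (P.gibbsMeasure L T) := (Lp.memLp v).ae_eq hae
    have hzero : ∀ x, v' x = 0 :=
      eq_zero_of_genOp_resolvent hω hl hβ γ L hT B hB (-σ) hc (κ := -lam0) (by linarith)
        (hv'C.of_le (by norm_cast)) hv'2 (fun x => hpde x)
    have : (v : PhaseSpace L → ℝ) =ᵐ[P.gibbsMeasure L T] 0 :=
      hae.trans (ae_of_all _ fun x => hzero x)
    exact Lp.eq_zero_iff_ae_eq_zero.2 this
  have hdense : (LinearMap.range Φ).topologicalClosure = ⊤ :=
    Submodule.topologicalClosure_eq_top_iff.2 hD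
  -- (Lim) approximate `k` from the range and pass to the limit
  set k' : Lp ℝ 2 (P.gibbsMeasure L T) := hk.toLp k with hk'
  have hkcl : k' ∈ closure ((LinearMap.range Φ : Submodule ℝ (Lp ℝ 2 (P.gibbsMeasure L T))) :
      Set (Lp ℝ 2 (P.gibbsMeasure L T))) := by
    rw [← Submodule.topologicalClosure_coe, hdense]
    trivial
  obtain ⟨u, hu1, hu⟩ := mem_closure_iff_seq_limit.1 hkcl
  choose ψ hψ using fun n => LinearMap.mem_range.1 (hu1 n)
  have hcau : CauchySeq fun n => Ψ (ψ n) := by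
    rw [Metric.cauchySeq_iff]
    intro ε hε
    obtain ⟨N₀, hN₀⟩ := Metric.cauchySeq_iff.1 hu.cauchySeq (lam0 * ε) (by positivity)
    refine ⟨N₀, fun m hm n hn => ?_⟩
    have h := hN₀ m hm n hn
    rw [dist_eq_norm] at h ⊢
    rw [← map_sub]
    have hb := hE (ψ m - ψ n)
    rw [map_sub Φ, hψ m, hψ n] at hb
    by_contra hcon
    push Not at hcon
    nlinarith
  obtain ⟨G, hG⟩ := cauchySeq_tendsto_of_complete hcau
  refine ⟨G, Lp.memLp G, fun φ hφ hφc => ?_⟩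
  -- the weak equation in the limit
  let Φ0 : 𝓓((⊤ : TopologicalSpace.Opens (PhaseSpace L)), ℝ) := ⟨φ, hφ, hφc, by simp⟩
  have hφ2 : ContDiff ℝ 2 φ := hφ.of_le (by norm_cast)
  have hMmem : MemLp (fun x => σ * liouvilleOp P L φ x + (-c) * bathOp L B T φ x + lam0 * φ x) 2
      (P.gibbsMeasure L T) :=
    memLp_two_of_hasCompactSupport _ (continuous_genOp hU1 hV1 L σ (-c) lam0 B T hφ2)
      (hasCompactSupport_genOp L σ (-c) lam0 B T hφ2 hφc)
  -- adjointness at finite `n`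
  have hadjn : ∀ n, ⟪Ψ (ψ n), hMmem.toLp _⟫_ℝ = ⟪u n, Ψ Φ0⟫_ℝ := by
    intro n
    rw [← hψ n, hΨ, hΦ, hΨ, inner_toLp_toLp, inner_toLp_toLp, P.integral_gibbsMeasure,
      P.integral_gibbsMeasure]
    congr 1
    have hadj := integral_genOp_mul_eq_adjoint P hU1 hV1 L hT.ne' (-σ) (-c) B lam0 (hD2 (ψ n))
      (ψ n).hasCompactSupport hφ2
    simp only [neg_neg] at hadj
    have l1 : (fun x => (ψ n : PhaseSpace L → ℝ) x *
        (σ * liouvilleOp P L φ x + (-c) * bathOp L B T φ x + lam0 * φ x) * P.gibbsDensity L T x) =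
        fun x => (ψ n : PhaseSpace L → ℝ) x *
          ((σ * liouvilleOp P L φ x + (-c) * bathOp L B T φ x + lam0 * φ x) * P.gibbsDensity L T x) :=
      funext fun x => by ring
    have l2 : (fun x => ((-σ) * liouvilleOp P L (ψ n) x + (-c) * bathOp L B T (ψ n) x +
        lam0 * (ψ n : PhaseSpace L → ℝ) x) * (Φ0 : PhaseSpace L → ℝ) x * P.gibbsDensity L T x) =
        fun x => ((-σ) * liouvilleOp P L (ψ n) x + (-c) * bathOp L B T (ψ n) x +
          lam0 * (ψ n : PhaseSpace L → ℝ) x) * (φ x * P.gibbsDensity L T x) :=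
      funext fun x => by
        rw [show (Φ0 : PhaseSpace L → ℝ) x = φ x from rfl]
        ring
    rw [l1, l2, hadj]
  -- pass to the limit on both sides
  have hlim1 : Tendsto (fun n => ⟪Ψ (ψ n), hMmem.toLp _⟫_ℝ) atTop (𝓝 ⟪G, hMmem.toLp _⟫_ℝ) :=
    hG.inner tendsto_const_nhds
  have hlim2 : Tendsto (fun n => ⟪u n, Ψ Φ0⟫_ℝ) atTop (𝓝 ⟪k', Ψ Φ0⟫_ℝ) :=
    hu.inner tendsto_const_nhds
  have heq : ⟪G, hMmem.toLp _⟫_ℝ = ⟪k', Ψ Φ0⟫_ℝ := by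
    refine tendsto_nhds_unique hlim1 ?_
    simpa only [hadjn] using hlim2
  rw [real_inner_comm, inner_toLp_left, hk', hΨ, inner_toLp_toLp] at heq
  -- `heq : ∫ Mφ · G = ∫ k φ`; the claim is its negative
  have e1 : ∫ x, (-σ * liouvilleOp P L φ x + c * bathOp L B T φ x + (-lam0) * φ x) * G x
      ∂(P.gibbsMeasure L T) =
      -∫ x, (σ * liouvilleOp P L φ x + (-c) * bathOp L B T φ x + lam0 * φ x) * G x
        ∂(P.gibbsMeasure L T) := by
    rw [← integral_neg]
    exact integral_congr_ae (ae_of_all _ fun x => by ring)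
  have e2 : ∫ x, (-k x) * φ x ∂(P.gibbsMeasure L T) = -∫ x, k x * φ x ∂(P.gibbsMeasure L T) := by
    rw [← integral_neg]
    exact integral_congr_ae (ae_of_all _ fun x => by ring)
  rw [e1, e2, heq]
  rfl


/-- **Resolvent fields, classical form.** For smooth `k ∈ L²(μ_T)` (same hypotheses): there is a
smooth `g_λ ∈ L²(μ_T)` with `λ g_λ − (σ X_H g_λ + c S_B g_λ) = k` POINTWISE (the weak solution of
`exists_resolvent_weak` made classical by Part III). [folklore] -/
theorem exists_resolventField (hω : 0 < ω₂) (hl : 0 ≤ lam) (hβ : 0 ≤ β) (γ : ℝ) (hL : 0 < L)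
    {T : ℝ} (hT : 0 < T) {σ c : ℝ} (hσ : σ ≠ 0) (hc : 0 < c) {B : Fin L → ℝ} (hB : ∀ i, 0 ≤ B i)
    (hB0 : 0 < B ⟨0, hL⟩) {lam0 : ℝ} (hlam : 0 < lam0) {k : PhaseSpace L → ℝ}
    (hks : ContDiff ℝ ∞ k) (hk : MemLp k 2 ((pinnedChain ω₂ lam β γ).gibbsMeasure L T)) :
    ∃ g : PhaseSpace L → ℝ, ContDiff ℝ ∞ g ∧ MemLp g 2 ((pinnedChain ω₂ lam β γ).gibbsMeasure L T) ∧
      ∀ x, lam0 * g x - (σ * liouvilleOp (pinnedChain ω₂ lam β γ) L g x + c * bathOp L B T g x) =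
        k x := by
  obtain ⟨g, hg2, hgw⟩ := exists_resolvent_weak hω hl hβ γ hL hT hσ hc hB hB0 hlam hk
  haveI : IsProbabilityMeasure ((pinnedChain ω₂ lam β γ).gibbsMeasure L T) :=
    pinnedChain_isProbabilityMeasure_gibbsMeasure hω hl hβ γ L hT
  obtain ⟨g', hg'C, hae, hpde⟩ := exists_classical_of_weak_gibbs hω hl hβ γ hL hT hσ hc hB hB0
    (-lam0) (hg2.integrable one_le_two) hks.neg (fun φ hφ hφc => hgw φ hφ hφc)
  refine ⟨g', hg'C, hg2.ae_eq hae, fun x => ?_⟩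
  have e : σ * liouvilleOp (pinnedChain ω₂ lam β γ) L g' x + c * bathOp L B T g' x +
      (-lam0) * g' x = -k x := hpde x
  linarith

/-- `p_s²` (in the `kin` form) is square integrable for the Gibbs state of the pinned chain
(`kin ≤ 2H ≤ 8T e^{H/(4T)}` and `e^{H/(2T)} ∈ L¹(μ_T)`). [folklore] -/
theorem pinnedChain_memLp_two_kin (hω : 0 < ω₂) (hl : 0 ≤ lam) (hβ : 0 ≤ β) (γ : ℝ) (L s : ℕ)
    {T : ℝ} (hT : 0 < T) : MemLp (kin L s) 2 ((pinnedChain ω₂ lam β γ).gibbsMeasure L T) := by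
  have hϑ : 1 / (2 * T) < 1 / T := by
    rw [one_div_lt_one_div (by positivity) hT]
    linarith
  have hexp := pinnedChain_integrable_exp_mul_hamiltonian_gibbsMeasure hω hl hβ γ L hT hϑ
  have hHc : Continuous ((pinnedChain ω₂ lam β γ).hamiltonian L) :=
    ((pinnedChain ω₂ lam β γ).contDiff_hamiltonian (n := 1) (pinnedChain_contDiff_U ω₂ lam β γ)
      (pinnedChain_contDiff_V ω₂ lam β γ) L).continuous
  have hg : MemLp (fun x => 8 * T * Real.exp (1 / (4 * T) * (pinnedChain ω₂ lam β γ).hamiltonian L x))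
      2 ((pinnedChain ω₂ lam β γ).gibbsMeasure L T) := by
    refine MemLp.const_mul ?_ _
    rw [memLp_two_iff_integrable_sq (by fun_prop)]
    refine hexp.congr (ae_of_all _ fun x => ?_)
    dsimp only
    rw [sq, ← Real.exp_add]
    congr 1
    ring
  refine hg.of_le (continuous_kin s).aestronglyMeasurable (ae_of_all _ fun x => ?_)
  rw [Real.norm_eq_abs, abs_of_nonneg (kin_nonneg s x), Real.norm_eq_abs,
    abs_of_nonneg (by positivity)]
  have h1 := kin_le_sum_sq s x
  have h2 := pinnedChain_harmonic_le_hamiltonian (ω₂ := ω₂) hl hβ γ L x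
  have h3 : 0 ≤ ∑ i, ω₂ * x.1 i ^ 2 / 2 := Finset.sum_nonneg fun i _ => by positivity
  have h4 : ∑ i, x.2 i ^ 2 = 2 * ∑ i, x.2 i ^ 2 / 2 := by
    rw [Finset.mul_sum]
    exact Finset.sum_congr rfl fun i _ => by ring
  have h5 : 1 / (4 * T) * (pinnedChain ω₂ lam β γ).hamiltonian L x ≤
      Real.exp (1 / (4 * T) * (pinnedChain ω₂ lam β γ).hamiltonian L x) := by
    have := Real.add_one_le_exp (1 / (4 * T) * (pinnedChain ω₂ lam β γ).hamiltonian L x)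
    linarith
  have hc : 4 * T * (1 / (4 * T)) = 1 := by field_simp
  calc kin L s x ≤ ∑ i, x.2 i ^ 2 := h1
    _ ≤ 2 * (pinnedChain ω₂ lam β γ).hamiltonian L x := by rw [h4]; linarith
    _ = 8 * T * (1 / (4 * T) * (pinnedChain ω₂ lam β γ).hamiltonian L x) := by
        rw [show 8 * T * (1 / (4 * T) * (pinnedChain ω₂ lam β γ).hamiltonian L x) =
          2 * (4 * T * (1 / (4 * T))) * (pinnedChain ω₂ lam β γ).hamiltonian L x by ring, hc]
        ring
    _ ≤ 8 * T * Real.exp (1 / (4 * T) * (pinnedChain ω₂ lam β γ).hamiltonian L x) :=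
        mul_le_mul_of_nonneg_left h5 (by positivity)

/-- **Resolvent forward fields of the γ-probed DEVICE exist, for every `λ > 0`.** For the device
(`pinnedChain ω₂ lam β γ`, `ω₂ > 0`, `lam, β ≥ 0`, `γ, T > 0`, `N + M ≥ 1`), any site `s` and
`λ > 0` there is a smooth `g_λ ∈ L²(μ_T)` with `λ g_λ − L_dev g_λ = p_s² − T` pointwise
(`L_dev = deviceGenerator … (fun _ => T)`). The stub's forward field is the `λ → 0` limit
`g = lim g_λ` (then `L_dev g = −(p_s² − T)`), which exists in `L²(μ_T)` iff `‖g_λ‖` stays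
bounded — the quantitative-ergodicity input not available in the tree. [folklore] -/
theorem exists_deviceResolventField (hω : 0 < ω₂) (hl : 0 ≤ lam) (hβ : 0 ≤ β) {γ : ℝ} (hγ : 0 < γ)
    {T : ℝ} (hT : 0 < T) {N M : ℕ} (hNM : 0 < N + M) (s : ℕ) {lam0 : ℝ} (hlam : 0 < lam0) :
    ∃ g : PhaseSpace (N + M) → ℝ, ContDiff ℝ ∞ g ∧
      MemLp g 2 ((pinnedChain ω₂ lam β γ).gibbsMeasure (N + M) T) ∧
      ∀ x, lam0 * g x - deviceGenerator (pinnedChain ω₂ lam β γ) N M (fun _ => T) g x =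
        kin (N + M) s x - T := by
  have hB : ∀ i, 0 ≤ deviceWeight N M i := fun i => by
    unfold deviceWeight OscillatorChain.bathWeight
    split_ifs <;> norm_num
  have hB0 : 0 < deviceWeight N M ⟨0, hNM⟩ := by
    unfold deviceWeight OscillatorChain.bathWeight
    simp only [if_true]
    split_ifs <;> norm_num
  haveI : IsProbabilityMeasure ((pinnedChain ω₂ lam β γ).gibbsMeasure (N + M) T) :=
    pinnedChain_isProbabilityMeasure_gibbsMeasure hω hl hβ γ (N + M) hT
  have hkin : ContDiff ℝ ∞ (fun x : PhaseSpace (N + M) => kin (N + M) s x - T) := by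
    unfold kin
    refine ContDiff.sub (ContDiff.sum fun i _ => ?_) contDiff_const
    split_ifs
    · exact ((contDiff_apply ℝ ℝ i).comp contDiff_snd).pow 2
    · exact contDiff_const
  have hkin2 : MemLp (fun x : PhaseSpace (N + M) => kin (N + M) s x - T) 2
      ((pinnedChain ω₂ lam β γ).gibbsMeasure (N + M) T) :=
    (pinnedChain_memLp_two_kin hω hl hβ γ (N + M) s hT).sub (memLp_const T)
  obtain ⟨g, hgC, hg2, hpde⟩ := exists_resolventField hω hl hβ γ hNM hT one_ne_zero hγ hB hB0
    hlam hkin hkin2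
  refine ⟨g, hgC, hg2, fun x => ?_⟩
  rw [deviceGenerator_eq]
  have e := hpde x
  rw [one_mul] at e
  exact e

end ResolventExistence

/-- Registered helper sub-goal `helper_dffDeviceResolventField` of stub `stub_deviceForwardFields`: existence of the device's resolvent forward fields (= `exists_deviceResolventField` in stub form). [folklore] -/
theorem helper_dffDeviceResolventField : ∀ (ω₂ lam β γ : ℝ), 0 < ω₂ → 0 ≤ lam → 0 ≤ β → 0 < γ → ∀ (T : ℝ), 0 < T → ∀ (N M : ℕ), 0 < N + M → ∀ (s : ℕ) (lam0 : ℝ), 0 < lam0 → ∃ g : PhaseSpace (N + M) → ℝ, ContDiff ℝ ∞ g ∧ MemLp g 2 ((pinnedChain ω₂ lam β γ).gibbsMeasure (N + M) T) ∧ ∀ x, lam0 * g x - deviceGenerator (pinnedChain ω₂ lam β γ) N M (fun _ => T) g x = kin (N + M) s x - T :=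
  fun _ _ _ _ hω hl hβ hγ _ hT _ _ hNM s _ hlam => exists_deviceResolventField hω hl hβ hγ hT hNM s hlam

end Summit.AtomisticToContinuum.FouriersLaw.Cruxes.SuperadditiveResistance.FloatingProbeBypassLaplacian

end
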